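import Summits.HodgeConjecture.HodgeConjecture.Theorems.F0P3HJ3aOfLettersCoh   -- ★ the `h2` heads (E1_coh edition): `hJ3a_of_S345` and every ★ input by name; this file is their TWO-COMPACT-PLACE twin
import Summits.HodgeConjecture.HodgeConjecture.Theorems.F0P3StubS3FoldCoh3     -- ★ (7a) `stubS3_holds_coh₃`
import Summits.HodgeConjecture.HodgeConjecture.Theorems.F0P3StubS4FoldCoh3     -- ★ (7b) `stubS4_holds_coh₃`
import Summits.HodgeConjecture.HodgeConjecture.Theorems.F0P3StubS5Fold3        -- ★ (7c) `stubS5_holds₃`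
import Summits.HodgeConjecture.HodgeConjecture.Theorems.F0FloorSockets         -- ★ the socket TYPES `HJ3aType`, `HdictEType`, `HoccType` BY NAME
import Summits.HodgeConjecture.HodgeConjecture.Theorems.F0P3ThreadLetters3Defs        -- ★ (S5-R20 (a)) the TWO-COMPACT-PLACE letter texts BY NAME: `StubE1coh₃`, `CohFinComponentUniqueHol₃∕Antihol₃`, `HodgeTypeRigid₃` (+ monotones, conjugation)
import HarnessLib

/-!
# Crux `H413` — row III-J3a `hJ3a` and `H413` FROM THE TWO-COMPACT-PLACE LETTERS (R90-TF THREAD-₃ link (7d)): `hJ3a_of_letters_coh₃`, `hJ3a_of_five_letters_coh₃`, `H413_of_five_letters_coh₃`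

Cell hodgecm-mathlib, crux item H413 = stmt-HodgeConjecture-24833; R90-TF slab S5 seat R90-C133-p01 (g2), deal (H21); S5 dealer R90-C133-plan (g3) RULING S5-R20 «ONE TEXT HOME, TWO LANES»; heir LEAD F0P3a-plan (g22) RULING (R-44) (C)(7) «S5 LOAN»; director (g40) s2043 (c)(ii)(iii); RULING S5-R19 «₃ twins live Summits-side»; census `R90/R90-C133-p01/g2/CENSUS-L7.md`.  PROOF lane (theorems only; no `def`, no instance, no notation, no `sorry`); ADDITIVE (new module; the ★ original is untouched and imported for its opens and lemmas); `--supports stmt-HodgeConjecture-24833 --as helper`.  HONEST LABEL: this file pays nothing; HC_CM is proved only modulo the 7 printed citations (2 remaining named inputs: hLiu418 = stmt-HodgeConjecture-24832, h413 = stmt-HodgeConjecture-24833) until rung 0 closes.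

WHAT THIS IS.  ★ `HJ3aOfLettersCoh.hJ3a_of_letters_coh hE1c hE1'h hE1'a hE2' hDh hDa hEh hEa := hJ3a_of_S345 (stubS3_holds_coh …) (stubS4_holds_coh …) (stubS5_holds …)` and its
five-letter ∕ `H413` companions, with the four ENGINE letters in their two-compact-place editions BY NAME (★ `F0P3ThreadLetters3Defs`: `StubE1coh₃`, `CohFinComponentUniqueHol₃`,
`CohFinComponentUniqueAntihol₃`, `HodgeTypeRigid₃`) and the three folds replaced by their ★ twins (7a) `stubS3_holds_coh₃`, (7b) `stubS4_holds_coh₃`, (7c) `stubS5_holds₃`; the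
★-PROVED letters (D)hol ∕ (D)antihol ∕ (E)hol ∕ (E)antihol by name as before; E1′a₃ from E1′h₃ by ★ `cohFinComponentUniqueAntihol₃_of_hol₃` (the `h2` Literature conjugation
`cohFinComponentUnique_antihol_of_hol` re-threaded).  CONCLUSIONS BY NAME = the floor socket types ★ `F0FloorSockets.HJ3aType` (row III-J3a, = the ★ heads' text ll. 76–80
byte for byte) and the crux `HCCMUnconditional.H413` (via ★ `Hyp413Closing.H413_of_three_facts_flat` with `hdictE : HdictEType`, `hocc : HoccType`) — UNCHANGED: `3 ≤ [K⁺:ℚ]`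
never surfaces above the folds, it is PRODUCED inside (7a)(7b)(7c) from Hyp413's `h6`.  AGG's «₃-THREAD» edition re-points `hJ3a_of_rung1 := hJ3a_of_five_letters_coh₃ stub_E1_coh₃
(stubE1hFold_holds_coh_cpt₃ stub_E1_coh₃ stub_F1a_cm stub_F1b_cm) stub_E2p₃` (heir LEAD (R-44)(C)(6)).
PRINT-FAITHFULNESS (director s2043 (iii)): «`3 ≤ [F⁺:ℚ]` is implied by Hyp413 (`6 ≤ [F:ℚ]`); the weakening costs nothing at the summit; anchor [Rogawski1990 §13.3 (13.3.6(c)), two compact places]» — the `3 ≤` clause is a ROUTE restriction of the R90-TF road (Arthur-simple trace formula: two compact real places), not Rogawski's hypothesis.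
References: [Liu2021] proof of Prop. 4.13 l. 2121–2146, Rem. 4.14; [Rogawski1990] Thm. 13.3.6 (c), Thm. 14.6.4, §15.3 ¶1; [BorelJacquet1979] §4.6; [BorelWallach2000] VI 4.11;
[GelbartRogawski1991] Thm 5.1.1; [Li1992] Thm. 2.1.
-/

-- the mandated namespace repeats `HodgeConjecture.HodgeConjecture`, as in every `Theorems/*.lean` of this sub-problem
set_option linter.dupNamespace false

noncomputable section

namespace Summit.HodgeConjecture.HodgeConjecture.Cruxes.H413.HJ3aOfLettersCoh3


open scoped TensorProduct Matrix ComplexOrder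
open NumberField NumberField.InfinitePlace IsDedekindDomain
open HodgeCM.Model HodgeCM.Model.LiuIndex HodgeCM.Model.TowerCarrier
open Summit.HodgeConjecture.CorCM.Model
open Literature.AlgebraicGeometry.Motives (CMType AbelianVariety)
open Literature.AlgebraicGeometry.HodgeTheory Literature.NumberTheory.Automorphic.PicardCM
open Literature.AlgebraicGeometry.ShimuraVarieties Literature.AlgebraicGeometry.ShimuraVarieties.UnitaryCanonicalModel
open Literature.NumberTheory.ComplexMultiplication
open Literature.NumberTheory.Automorphic
open Literature.NumberTheory.Automorphic.Liu2021 Literature.NumberTheory.Automorphic.Liu2021.AppendixC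
open Literature.NumberTheory.Automorphic.Liu2021.Def411WeilCarriers (lineOf locF Rep)
open Summit.HodgeConjecture.CorCM.Transposition.OmegaTransport (realUnit)
open HodgeCM.Model.ArchSideTerm (e₁)
open Literature.NumberTheory.GelbartRogawski1991 Literature.NumberTheory.GelbartRogawski1991.UnitaryDualPair
open Literature.RepresentationTheory Literature.RepresentationTheory.Liu2021
open Summit.HodgeConjecture.CorCM
open Summit.HodgeConjecture.CorCM.Transposition
open Literature.NumberTheory.GelbartRogawski1991.OscillatorTripleDictionary (OccursInH1 IsIsoToOmega)
open Summit.HodgeConjecture.CorCM.Lines.A3Liu418 (Thm415AtFace EpsRigidAtFace)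
open Summit.HodgeConjecture.HodgeConjecture.Theses (HCCMUnconditional.HDel)
open MulAction
open Literature.Geometry.ComplexHyperbolic.BallModel (U21 x₀)
open Literature.NumberTheory.GelbartRogawski1991.OscillatorTripleDictionary (rhoTriple)
open Summit.HodgeConjecture.CorCM.Lines.A3Liu413 (datum413)
open Summit.HodgeConjecture.HodgeConjecture.Cruxes.H413.CohFormsCarriers
open Summit.HodgeConjecture.HodgeConjecture.Cruxes.H413.F0P3HJ3aAssembly (hJ3a_of_S345)
open Summit.HodgeConjecture.HodgeConjecture.Cruxes.H413.F0P3StubS5Fold (stubS5_holds)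
open Literature.NumberTheory.Automorphic.UnitaryGroup.CotangentForms (cohFinComponentUnique_antihol_of_hol antiholCotFormSpectralProjection_of_hol cohIsotypicLine_antihol_of_hol)
open Summit.HodgeConjecture.HodgeConjecture.Cruxes.H413.F0P3StubS3FoldCoh (stubS3_holds_coh)
open Summit.HodgeConjecture.HodgeConjecture.Cruxes.H413.F0P3StubS4FoldCoh (stubS4_holds_coh)
open Summit.HodgeConjecture.HodgeConjecture.Cruxes.H413.F0P3StubS3FoldCoh3 (stubS3_holds_coh₃)
open Summit.HodgeConjecture.HodgeConjecture.Cruxes.H413.F0P3StubS4FoldCoh3 (stubS4_holds_coh₃)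
open Summit.HodgeConjecture.HodgeConjecture.Cruxes.H413.F0P3StubS5Fold3 (stubS5_holds₃)
open Summit.HodgeConjecture.HodgeConjecture.Cruxes.H413.F0P3ThreadLetters3Defs

set_option synthInstance.maxHeartbeats 400000 in
set_option maxHeartbeats 8000000 in
/-- **`hJ3a` (socket ★ `F0FloorSockets.HJ3aType`) FROM THE EIGHT LETTERS, TWO-COMPACT-PLACE EDITION** — ★ `hJ3a_of_letters_coh` with E1_coh₃, E1′h₃, E1′a₃, E2′₃ BY NAME and the folds
(7a)(7b)(7c); (D)∕(E) letters ★ by name.  HC_CM is proved only modulo the printed citations until rung 0 closes. [cite: Liu2021, proof of Prop. 4.13, l. 2121–2146; Rem. 4.14]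
[cite: Rogawski1990, Thm. 14.6.4; Thm. 13.3.6 (c); §15.3 ¶1; §12.3 p. 174; Thm. 13.3.5] [cite: BorelJacquet1979, §4.6] [cite: BorelWallach2000, VII 3.2 and 3.6] -/
theorem hJ3a_of_letters_coh₃ (hE1c : StubE1coh₃) (hE1'h : CohFinComponentUniqueHol₃) (hE1'a : CohFinComponentUniqueAntihol₃) (hE2' : HodgeTypeRigid₃)
    (hDh : Literature.NumberTheory.Automorphic.UnitaryGroup.CotangentForms.holCotFormSpectralProjection)
    (hDa : Literature.NumberTheory.Automorphic.UnitaryGroup.CotangentForms.antiholCotFormSpectralProjection)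
    (hEh : Literature.NumberTheory.Automorphic.UnitaryGroup.CotangentForms.cohIsotypicLine_hol)
    (hEa : Literature.NumberTheory.Automorphic.UnitaryGroup.CotangentForms.cohIsotypicLine_antihol) :
    Summit.HodgeConjecture.HodgeConjecture.Theorems.F0FloorSockets.HJ3aType :=
  hJ3a_of_S345 (stubS3_holds_coh₃ hE1c hE1'h hDh hEh) (stubS4_holds_coh₃ hE1c hE1'a hDa hEa) (stubS5_holds₃ hE2' hDh hDa)

set_option synthInstance.maxHeartbeats 400000 in
set_option maxHeartbeats 8000000 in
/-- **THE CRUX `HCCMUnconditional.H413` BY NAME FROM THE EIGHT TWO-COMPACT-PLACE LETTERS AND THE TWO OTHER FLOOR ROWS** (`hdictE : HdictEType` = row III-2 (a)′, `hocc : HoccType` =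
row III-2 (c)′), via ★ `Hyp413Closing.H413_of_three_facts_flat`.  HC_CM is proved only modulo the printed citations until rung 0 closes. [cite: Liu2021, Prop. 4.13; Rem. 4.14]
[cite: Rogawski1990, Thm. 14.6.4; §15.3] [cite: GelbartRogawski1991, Thm 5.1.1 p. 465] [cite: Li1992, Thm. 2.1] -/
theorem H413_of_letters_coh₃ (hE1c : StubE1coh₃) (hE1'h : CohFinComponentUniqueHol₃) (hE1'a : CohFinComponentUniqueAntihol₃) (hE2' : HodgeTypeRigid₃)
    (hDh : Literature.NumberTheory.Automorphic.UnitaryGroup.CotangentForms.holCotFormSpectralProjection)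
    (hDa : Literature.NumberTheory.Automorphic.UnitaryGroup.CotangentForms.antiholCotFormSpectralProjection)
    (hEh : Literature.NumberTheory.Automorphic.UnitaryGroup.CotangentForms.cohIsotypicLine_hol)
    (hEa : Literature.NumberTheory.Automorphic.UnitaryGroup.CotangentForms.cohIsotypicLine_antihol)
    (hdictE : Summit.HodgeConjecture.HodgeConjecture.Theorems.F0FloorSockets.HdictEType) (hocc : Summit.HodgeConjecture.HodgeConjecture.Theorems.F0FloorSockets.HoccType) :
    Summit.HodgeConjecture.HodgeConjecture.Theses.HCCMUnconditional.H413 :=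
  Summit.HodgeConjecture.CorCM.Hyp413Closing.H413_of_three_facts_flat hdictE (hJ3a_of_letters_coh₃ hE1c hE1'h hE1'a hE2' hDh hDa hEh hEa) hocc

set_option synthInstance.maxHeartbeats 400000 in
set_option maxHeartbeats 8000000 in
/-- **`hJ3a` FROM FIVE LETTERS, TWO-COMPACT-PLACE EDITION** — ★ `hJ3a_of_five_letters_coh` twin: E1_coh₃, E1′h₃, E2′₃ by name, (D)hol, (E)hol ★; the `(0,1)` twins by conjugation (E1′a₃ ★
`cohFinComponentUniqueAntihol₃_of_hol₃`; (D)a ∕ (E)a ★ Literature `…_of_hol`).  The head AGG's ₃ edition feeds with `stub_E1_coh₃`, `stubE1hFold_holds_coh_cpt₃ …`, `stub_E2p₃`.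
HC_CM is proved only modulo the printed citations until rung 0 closes. [cite: Liu2021, proof of Prop. 4.13, l. 2121–2146] [cite: Rogawski1990, Thm. 14.6.4; §15.3 ¶1] [cite: BorelWallach2000, VI 4.11] -/
theorem hJ3a_of_five_letters_coh₃ (hE1c : StubE1coh₃) (hE1'h : CohFinComponentUniqueHol₃) (hE2' : HodgeTypeRigid₃)
    (hDh : Literature.NumberTheory.Automorphic.UnitaryGroup.CotangentForms.holCotFormSpectralProjection)
    (hEh : Literature.NumberTheory.Automorphic.UnitaryGroup.CotangentForms.cohIsotypicLine_hol) :
    Summit.HodgeConjecture.HodgeConjecture.Theorems.F0FloorSockets.HJ3aType :=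
  hJ3a_of_letters_coh₃ hE1c hE1'h (cohFinComponentUniqueAntihol₃_of_hol₃ hE1'h) hE2' hDh (antiholCotFormSpectralProjection_of_hol hDh) hEh (cohIsotypicLine_antihol_of_hol hEh)

set_option synthInstance.maxHeartbeats 400000 in
set_option maxHeartbeats 8000000 in
/-- **THE CRUX `HCCMUnconditional.H413` BY NAME FROM FIVE TWO-COMPACT-PLACE LETTERS AND THE TWO OTHER FLOOR ROWS** — ★ `H413_of_five_letters_coh` twin (AGG's `H413_of_rung1` re-points here).
HC_CM is proved only modulo the printed citations until rung 0 closes. [cite: Liu2021, Prop. 4.13; Rem. 4.14] [cite: Rogawski1990, Thm. 14.6.4; §15.3] -/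
theorem H413_of_five_letters_coh₃ (hE1c : StubE1coh₃) (hE1'h : CohFinComponentUniqueHol₃) (hE2' : HodgeTypeRigid₃)
    (hDh : Literature.NumberTheory.Automorphic.UnitaryGroup.CotangentForms.holCotFormSpectralProjection)
    (hEh : Literature.NumberTheory.Automorphic.UnitaryGroup.CotangentForms.cohIsotypicLine_hol)
    (hdictE : Summit.HodgeConjecture.HodgeConjecture.Theorems.F0FloorSockets.HdictEType) (hocc : Summit.HodgeConjecture.HodgeConjecture.Theorems.F0FloorSockets.HoccType) :
    Summit.HodgeConjecture.HodgeConjecture.Theses.HCCMUnconditional.H413 :=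
  Summit.HodgeConjecture.CorCM.Hyp413Closing.H413_of_three_facts_flat hdictE (hJ3a_of_five_letters_coh₃ hE1c hE1'h hE2' hDh hEh) hocc

end Summit.HodgeConjecture.HodgeConjecture.Cruxes.H413.HJ3aOfLettersCoh3

end
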